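import Summits.HodgeConjecture.CorCM.AndreProductFormBiproduct
import Literature.AlgebraicGeometry.ComplexMultiplication.ShimuraIsogenyOfRiemann
import Literature.AlgebraicGeometry.ComplexMultiplication.ShimuraInflationBettiJunctions
import HarnessLib

/-!
# COR-CM (cell `pub-hodgecm2`), A1 line — step L2: twist isogenies between realisations of
# Galois-translated CM types, and their effect on the `H¹`-eigenlines

HONEST FRAMING (cell pub-hodgecm2 / COR-CM, seat b30 gen 11; COUNT-NEUTRAL — no binder row of
`HOME/BINDER-OWNERS.md`, no case of the Hodge conjecture, nothing about algebraic cycles).  Step L2 of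
`HOME/pub-hodgecm2-lit-andre-3/A1-BLUEPRINT.md` ("the three primitive slots are `K`-equivariantly isogenous to
twists of ONE realisation"), on the tree's real carriers and for an ARBITRARY CM field `K` (the cyclic sextic
case is the consumer, file name kept from the seat's claim):

* `complexBetti_map_one_bijective_of_isIsogeny` — an isogeny `u : A′ ⟶ A` of complex abelian varieties is
  bijective on `H¹(−(ℂ); ℂ)` (quasi-inverse `u ≫ u′ = n • 𝟙`, Mumford §19, the tree's theorem
  `IsIsogeny.exists_nsmul_inverse_holds`, and additivity of `f ↦ f^*` on `H¹`, `complexBetti_map_add_one`).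
* `exists_twistIsogeny` — for realisations `(A, ι, θ)` of `(K; Φ)` and `(A′, ι′, θ′)` of the TRANSLATED type
  `(K; Φ^e)`, `Φ^e = cmTypeMap e Φ = {s | s ∘ e ∈ Φ}` (`e ∈ Aut K`), Shimura's Corollary (`Shimura1998_Thm2_Cor`,
  a theorem of the tree modulo Riemann's theorem `hR`: `thm2_cor_of_riemann`) applied to `(A′, ι′)` and the
  TWISTED realisation `(A, ι ∘ 𝓞(e⁻¹))` (`IsCMTypeRealisation.transport`) gives an isogeny `u : A′ ⟶ A` with
  `ι′(a) ≫ u = u ≫ ι(e⁻¹ a)`.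
* `map_mem_eigenline_of_twist` — such a `u` pulls the `t`-eigenline of `θ` on `H¹(A)` back into the
  `(t ∘ e⁻¹)`-eigenline of `θ′` on `H¹(A′)` (and is injective there).

THEOREMS ONLY; no `sorry`; axioms `propext`, `Classical.choice`, `Quot.sound`.

## References
* [Shimura1998] G. Shimura, *Abelian Varieties with Complex Multiplication and Modular Functions* (1998),
  §6.1 Corollary of Theorem 2 and Remark (p. 41).
* [MumfordAV1970] D. Mumford, *Abelian Varieties* (1970), §19 Remark p. 169 (quasi-inverse of an isogeny).
* [Deligne1982HodgeCycles] P. Deligne (notes by J. S. Milne), LNM 900 (1982), endnote M.12 ("`(A, ν∘σ)` is of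
  CM-type `Φσ`").
-/

noncomputable section

namespace Summit.HodgeConjecture.CorCM.CyclicSextic

open CategoryTheory CategoryTheory.Limits NumberField
open Literature.AlgebraicGeometry Literature.AlgebraicGeometry.Motives Literature.AlgebraicGeometry.HodgeTheory
open Literature.AlgebraicGeometry.ComplexMultiplication
open Literature.NumberTheory.Automorphic.PicardCM (eigenline mem_eigenline_of_forall_integer)
open Literature.NumberTheory.Automorphic.PicardCM.CMCode (cmTypeMap)
open Summit.HodgeConjecture.HodgeConjecture.Theorems.HodgeAbelianVarieties.CMPivotAndre

/-! ## Isogenies are bijective on `H¹(−(ℂ); ℂ)` -/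

section Isogeny

variable {A A' : AbelianVariety ℂ}

/-- `(n • 𝟙 A)^* = n` on `H¹(A(ℂ); ℂ)`. [cite: MumfordAV1970, §19] -/
theorem complexBetti_map_nsmul_id_one_apply (n : ℕ) (x : complexBetti A.X 1) :
    complexBetti.map (n • 𝟙 A : A ⟶ A).hom.hom.hom 1 x = (n : ℂ) • x := by
  rw [complexBetti_map_nsmul_one]
  change (n • complexBetti.map (𝟙 A : A ⟶ A).hom.hom.hom 1).hom x = _
  rw [ModuleCat.hom_nsmul, LinearMap.smul_apply, complexBetti_map_id_one_apply, Nat.cast_smul_eq_nsmul]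

/-- **An isogeny of complex abelian varieties is bijective on `H¹(−(ℂ); ℂ)`**: with a quasi-inverse
`u′` (`u ≫ u′ = n • 𝟙`, `u′ ≫ u = n • 𝟙`, `n ≥ 1`) one has `u′^* ∘ u^* = n = u^* ∘ u′^*` on `H¹`, and `n`
is invertible in `ℂ`. [cite: MumfordAV1970, §19 Remark p. 169] -/
theorem complexBetti_map_one_bijective_of_isIsogeny {u : A' ⟶ A} (hu : AbelianVariety.IsIsogeny u) :
    Function.Bijective (complexBetti.map u.hom.hom.hom 1) := by
  obtain ⟨u', n, hn, h1, h2⟩ := AbelianVariety.IsIsogeny.exists_nsmul_inverse_holds hu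
  -- `h1 : u ≫ u' = n • 𝟙 A'`, `h2 : u' ≫ u = n • 𝟙 A`
  have hn0 : (n : ℂ) ≠ 0 := by exact_mod_cast hn.ne'
  refine ⟨fun x y hxy => ?_, fun x => ?_⟩
  · -- injective: apply `u'^*` and use `u'^* (u^* z) = (u' ≫ u)^* z = n • z`
    have hx := congrArg (complexBetti.map u'.hom.hom.hom 1) hxy
    rw [complexBetti_map_map_one_apply, complexBetti_map_map_one_apply, h2,
      complexBetti_map_nsmul_id_one_apply, complexBetti_map_nsmul_id_one_apply] at hx
    exact smul_right_injective _ hn0 hx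
  · -- surjective: `x = u^* (u'^* (n⁻¹ • x))`
    refine ⟨complexBetti.map u'.hom.hom.hom 1 ((n : ℂ)⁻¹ • x), ?_⟩
    rw [complexBetti_map_map_one_apply, h1, complexBetti_map_nsmul_id_one_apply, smul_smul,
      mul_inv_cancel₀ hn0, one_smul]

end Isogeny

/-! ## Twist isogenies between realisations of `Φ` and of `Φ^e` -/

section Twist

variable {K : Type} [Field K] [NumberField K] [IsCMField K]
variable {Φ : CMType K} {A : AbelianVariety ℂ} {ι : 𝓞 K →+* End A}
  {θ : K →+* Module.End ℂ (complexBetti A.X 1)}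
variable {A' : AbelianVariety ℂ} {ι' : 𝓞 K →+* End A'} {θ' : K →+* Module.End ℂ (complexBetti A'.X 1)}

/-- **Twist isogeny** (Shimura's Corollary applied to `(A′, ι′)` and the twisted realisation
`(A, ι ∘ 𝓞(e⁻¹))` of `Φ^e`): for a realisation `(A, ι, θ)` of `(K; Φ)` and a realisation `(A′, ι′, θ′)` of
the translated type `Φ^e = {s | s ∘ e ∈ Φ}` there is an isogeny `u : A′ ⟶ A` intertwining `ι′(a)` with
`ι(e⁻¹ a)`. [cite: Shimura1998, §6.1 Corollary of Theorem 2 and Remark, p. 41]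
[cite: Deligne1982HodgeCycles, endnote M.12 (p. 64)] -/
theorem exists_twistIsogeny (hcor : Shimura1998_Thm2_Cor) (hA : IsCMTypeRealisation Φ A ι θ) (e : K ≃+* K)
    (hA' : IsCMTypeRealisation (cmTypeMap e Φ) A' ι' θ') :
    ∃ u : A' ⟶ A, AbelianVariety.IsIsogeny u ∧
      ∀ a : 𝓞 K, ι' a ≫ u = u ≫ ι (RingOfIntegers.mapRingEquiv e.symm a) := by
  obtain ⟨u, hu, hcomm⟩ := hcor K (cmTypeMap e Φ) A' ι' θ' A
    (ι.comp (RingOfIntegers.mapRingEquiv e.symm).toRingHom) (θ.comp e.symm.toRingHom) hA' (hA.transport e)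
  exact ⟨u, hu, fun a => hcomm a⟩

/-- The same modulo Riemann's theorem only (`hR`, the displayed binder B02 of the cell): Shimura's Corollary
is the tree's theorem `thm2_cor_of_riemann hR`. [cite: Shimura1998, §6.1 Corollary of Theorem 2 and Remark, p. 41] -/
theorem exists_twistIsogeny_of_riemann (hR : DeligneMilne1982_Thm_6_20_full) (hA : IsCMTypeRealisation Φ A ι θ)
    (e : K ≃+* K) (hA' : IsCMTypeRealisation (cmTypeMap e Φ) A' ι' θ') :
    ∃ u : A' ⟶ A, AbelianVariety.IsIsogeny u ∧
      ∀ a : 𝓞 K, ι' a ≫ u = u ≫ ι (RingOfIntegers.mapRingEquiv e.symm a) :=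
  exists_twistIsogeny (thm2_cor_of_riemann hR) hA e hA'

omit [IsCMField K] in
/-- **Twisted equivariance transports eigenlines**: if `u : A′ ⟶ A` satisfies `ι′(a) ≫ u = u ≫ ι(e⁻¹ a)` for
all `a ∈ 𝓞_K`, then `u^*` maps the `t`-eigenline of `θ` (`θ(a) = ι(a)^*` on `𝓞_K`) into the
`(t ∘ e⁻¹)`-eigenline of `θ′`: for `a ∈ 𝓞_K`, `ι′(a)^* u^* v = (ι′(a) ≫ u)^* v = (u ≫ ι(e⁻¹a))^* v
= u^* ι(e⁻¹ a)^* v = t(e⁻¹ a) · u^* v`, and the integers cut out the eigenline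
(`mem_eigenline_of_forall_integer`). [cite: Deligne1982HodgeCycles, endnote M.12 (p. 64)] -/
theorem map_mem_eigenline_of_twist (hA : IsCMTypeRealisation Φ A ι θ) {Φ' : CMType K}
    (hA' : IsCMTypeRealisation Φ' A' ι' θ') (e : K ≃+* K) {u : A' ⟶ A}
    (hu : ∀ a : 𝓞 K, ι' a ≫ u = u ≫ ι (RingOfIntegers.mapRingEquiv e.symm a))
    {t : K →+* ℂ} {v : complexBetti A.X 1} (hv : v ∈ eigenline θ t) :
    complexBetti.map u.hom.hom.hom 1 v ∈ eigenline θ' (t.comp e.symm.toRingHom) := by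
  refine mem_eigenline_of_forall_integer θ' _ fun a => ?_
  have h1 : θ' (algebraMap (𝓞 K) K a) = (complexBetti.map (ι' a).hom.hom.hom 1).hom := (hA'.2.2.1 a).symm
  rw [h1]
  change complexBetti.map (ι' a).hom.hom.hom 1 (complexBetti.map u.hom.hom.hom 1 v) = _
  rw [complexBetti_map_map_one_apply, hu a, ← complexBetti_map_map_one_apply,
    AndreProductForm.map_ι_apply_of_mem_eigenline hA hv, map_smul]
  rfl

/-- **L2 packaged**: modulo Riemann's theorem, a realisation `(A′, ι′, θ′)` of the translated type `Φ^e`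
admits an isogeny `u : A′ ⟶ A` onto any realisation `(A, ι, θ)` of `Φ`, bijective on `H¹(−(ℂ); ℂ)`,
intertwining `ι′(a)` with `ι(e⁻¹ a)`, and carrying the `t`-eigenline of `A` into the `(t ∘ e⁻¹)`-eigenline
of `A′`. [cite: Shimura1998, §6.1 Corollary of Theorem 2 and Remark, p. 41]
[cite: Deligne1982HodgeCycles, endnote M.12 (p. 64)] -/
theorem exists_twistIsogeny_eigenline_of_riemann (hR : DeligneMilne1982_Thm_6_20_full)
    (hA : IsCMTypeRealisation Φ A ι θ) (e : K ≃+* K) (hA' : IsCMTypeRealisation (cmTypeMap e Φ) A' ι' θ') :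
    ∃ u : A' ⟶ A, AbelianVariety.IsIsogeny u ∧ Function.Bijective (complexBetti.map u.hom.hom.hom 1) ∧
      (∀ a : 𝓞 K, ι' a ≫ u = u ≫ ι (RingOfIntegers.mapRingEquiv e.symm a)) ∧
      ∀ (t : K →+* ℂ) (v : complexBetti A.X 1), v ∈ eigenline θ t →
        complexBetti.map u.hom.hom.hom 1 v ∈ eigenline θ' (t.comp e.symm.toRingHom) := by
  obtain ⟨u, hu, hcomm⟩ := exists_twistIsogeny_of_riemann hR hA e hA'
  exact ⟨u, hu, complexBetti_map_one_bijective_of_isIsogeny hu, hcomm,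
    fun t v hv => map_mem_eigenline_of_twist hA hA' e hcomm hv⟩

end Twist

end Summit.HodgeConjecture.CorCM.CyclicSextic

end
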